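import Literature.Probability.LatticeModels.FKIsingNaturalMartingale
import Literature.Probability.RandomPlanarGeometry.SLETransienceKappaFourEight
import Literature.Probability.RandomPlanarGeometry.SLEExistenceAt
import Literature.Probability.RandomPlanarGeometry.SLEUniquenessInLaw
import Literature.Probability.RandomPlanarGeometry.LocalMartingaleProofs
import Literature.Probability.RandomPlanarGeometry.RohdeSchrammCor35Proofs
import Literature.Probability.Process.LevyCharacterisation
import HarnessLib

/-!
# FK-Ising interfaces and SLE_{16/3}: the named-fact frontier of the identification step (L)

Topic `Literature/Probability/LatticeModels` (family `crit-ising`). Bookkeeping file, theorems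
only (no definition, no named fact), for the identification fact **(L)**
`Literature.Probability.LatticeModels.isSLELaw_of_isSubseqLimitLaw_fkInterfaceCurve` of
`FKIsingInterfaceSLE.lean` — every subsequential weak limit of the critical FK-Ising Dobrushin
interface laws of a discretised Dobrushin domain `(D; a, b)` is the chordal SLE_{16/3} law of
`(D; a, b)` (Chelkak–Duminil-Copin–Hongler–Kemppainen–Smirnov, C. R. Math. Acad. Sci. Paris 352
(2014), Thm. 2 with Thm. 3 and §3; Duminil-Copin–Smirnov, Clay Math. Proc. 15 (2012), Thm. 6.4 and
Prop. 6.7) — the FK counterpart of `InterfaceSLEAssembly.lean` (spin half).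

Layers 2–4 of the tree (`FKIsingInterfaceIdentification.lean`, `FKIsingDrivingMartingale.lean`,
`FKIsingObservableMartingale.lean`) prove
(L) ⟸ `hasSLETrace_of_ne_eight` ∧ `tendsto_norm_sleTrace_atTop` ∧ `levy_characterisation` ∧ (L‴),
where (L‴) = `exists_observableMartingale_fkInterface` is the observable martingale statement of
Duminil-Copin–Smirnov's proof of Prop. 6.7 (p. 29: "`M_t(z') := lim M^δ_{τ_t}(z')` is a
martingale … `√π M_t^z = √(g_t'(z)/(g_t(z) - W_t))` is a martingale"; CDHKS §3: "the process
`M_t(z)` … is a martingale with respect to the filtration generated by `W_t`") and the two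
Rohde–Schramm facts are the GLOBAL trace theorems (all `κ ≠ 8`, resp. all `κ > 0` — the latter
resting, for `κ ≥ 8`, on Lawler–Schramm–Werner's SLE₈ theorem and Rohde–Schramm's Lemma 7.3).
Three things are recorded here, all PROVED.

* **The frontier of (L) is two named facts, read at `κ = 16/3` only**
  (`isSLELaw_of_isSubseqLimitLaw_fkInterfaceCurve_of_cor35`): Rohde–Schramm's one-point
  derivative estimate Cor. 3.5 on the canonical space (`RohdeSchramm2005_cor35 preWienerMeasure`,
  `SLEDerivativeEstimates.lean`), through which the tree proves both `HasSLETrace (16/3)`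
  (`hasSLETrace_of_ne_eight_of_cor35`, Thm. 5.1) and the transience of the SLE_{16/3} trace
  (`tendsto_norm_sleTrace_atTop_of_cor35_of_four_lt_of_lt_eight`, Thm. 7.1 for `4 < κ < 8`), and
  (L‴). Lévy's characterisation is the theorem `Process.levy_characterisation_holds`. The glue is
  the `κ`-local form of the tree's transport theorems (`isSLELaw_of_isSLEDrivingCoupling`,
  `isSLELaw_of_isLocalMartingale_driving`, which consume the global transience fact only to build
  an SLE_κ random curve through a uniformizing map): here the SLE_{16/3} random curve is taken from
  `exists_isSLECurve_at` and its own uniformizing map is fed to (L″), which is universal in the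
  uniformizing map (`isSLELaw_of_isSLEDrivingCoupling_through`,
  `isSLELaw_of_isLocalMartingale_driving_through`,
  `isSLELaw_of_isSubseqLimitLaw_fkInterfaceCurve_of_isSLECurve`). Consequently crit-ising.S17 (FK)
  follows from three named facts (`convergesInLawToSLE_sixteen_thirds_fkInterface_of_cor35`:
  Cor. 3.5, the FK traversal bound (C1) `fkInterface_traversalBound`, (L‴)).
* **(L) is implied by CDHKS Theorem 2 as transcribed**
  (`isSLELaw_of_isSubseqLimitLaw_fkInterfaceCurve_of_convergesInLawToSLE`): a subsequential limit
  law of a family converging in law is the limit law (bounded continuous functions determine finite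
  Borel measures on the metric space `CurveClass ℂ`; `eq_map_of_isSubseqLimitLaw_of_tendstoLaw`).
  So (L) is no stronger than `convergesInLawToSLE_sixteen_thirds_fkInterface`, and with (T) and
  uniqueness of the SLE law (layer 1) the two are equivalent.
* **The Rohde–Schramm inputs at `κ = 16/3` are necessary**
  (`hasSLETrace_and_transient_sixteen_thirds_of_facts`): under the tightness fact (T), on every
  Dobrushin domain admitting admissible discretisations (L) exhibits an SLE_{16/3} random curve,
  hence `HasSLETrace (16/3)` and a.s. transience of the SLE_{16/3} trace
  (`hasSLETrace_and_transient_of_isSLECurve`, `SLEExistenceAt.lean`). No proof of (L) can bypass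
  Rohde–Schramm's theorem at `κ = 16/3` on a non-vacuous instance.

After this file the named-fact frontier below (L) is: `RohdeSchramm2005_cor35` (at the canonical
Brownian motion) and `exists_observableMartingale_fkInterface`; below crit-ising.S17 (FK)
additionally `fkInterface_traversalBound`. Nothing is redefined; no named fact is introduced.

**Update (the frontier of (L) is one named fact).** Rohde–Schramm's Cor. 3.5 is meanwhile a
theorem of the tree on every probability space carrying a Brownian motion with continuous paths
(`RandomPlanarGeometry.RohdeSchramm2005_cor35_holds`, `RohdeSchrammCor35Proofs.lean`). The last
section records the consequences for (L), all PROVED and unconditional: SLE_{16/3} is generated by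
an a.s. transient curve (`hasSLETrace_and_transient_sixteen_thirds`), chordal SLE_{16/3} random
curves exist in every Dobrushin domain (`exists_isSLECurve_sixteen_thirds`), and (L) follows from
either intermediate statement of layers 3–4 alone — (L″) `exists_drivingMartingale_fkInterface`,
(L‴) `exists_observableMartingale_fkInterface`
(`isSLELaw_of_isSubseqLimitLaw_fkInterfaceCurve_of_exists_observableMartingale`). So the
named-fact frontier below (L) is now (L‴) alone — the observable martingale of the limit, whose
printed proof is the convergence of the driving processes (Kemppainen–Smirnov 2017, Thm. 1.5,
from CDHKS Thm. 4) and the discrete fermionic observable martingales with Smirnov's convergence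
theorem (Duminil-Copin–Smirnov 2012, Lemma 6.6 and Thm. 3.15 = Smirnov 2010, Thm. 2.2), glued
by the proved passage to the limit of `RandomPlanarGeometry/ObservableLimitPassage.lean` and
`FKIsingCylinderIdentityAssembly.lean` (where those printed inputs are theorem hypotheses).
**D-0026 review (2026-08-15).** For a while the frontier was read one layer lower, at CDHKS's
observable martingale identity against cylinder test functions (M5′), vendored as the closed named
fact `exists_cylinderObservableIdentity_fkInterface` (`FKIsingNaturalMartingale.lean`), with the
literal natural-filtration sentence (M5) of CDHKS §3 as its proved consequence. The bad-split
review found (M5′) to be a step of the parent's own printed proof (the displayed claim of CDHKS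
§3 = one sentence of DCS p. 29) one proved lemma above two distinct published theorems the tree
does not yet hold, and merged it back into the proof obligation; the corollaries of this file
that consumed it now consume (L‴).

## References

* D. Chelkak, H. Duminil-Copin, C. Hongler, A. Kemppainen, S. Smirnov, *Convergence of Ising
  interfaces to Schramm's SLE curves*, C. R. Math. Acad. Sci. Paris 352 (2014) 157–161
  (arXiv:1312.0533): Thm. 2 (arXiv p. 4), Thm. 3 (§2, p. 5), §3 (pp. 7–8: "`M_t(z)` … is a
  martingale with respect to the filtration generated by `W_t`"; "Lévy's theorem implies that
  `W_t = √3 B_t` … for any subsequential limit"; "the similar derivation of Theorem 2 from [Smi10]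
  can be found in [DCS12]").
* H. Duminil-Copin, S. Smirnov, *Conformal invariance of lattice models*, Clay Math. Proc. 15
  (2012) 213–276 (arXiv:1109.1549): Thm. 6.4, Prop. 6.7 and proof of Thm. 3.13 (p. 29).
* S. Rohde, O. Schramm, *Basic properties of SLE*, Ann. of Math. 161 (2005) 883–924: Cor. 3.5,
  Thm. 5.1, Thm. 7.1.
* P. Billingsley, *Convergence of Probability Measures*, 2nd ed. (1999), Thm. 1.2 (bounded
  continuous functions determine a probability measure on a metric space), Thm. 2.6.
-/

noncomputable section

open MeasureTheory Filter Topology ProbabilityTheory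
open UpperHalfPlane (upperHalfPlaneSet)
open scoped NNReal ENNReal BoundedContinuousFunction
open Literature.Probability.LatticeModels Literature.Probability.Percolation
open Literature.Probability.RandomPlanarGeometry (CurveClass Curve DobrushinDomain ConformalEquiv
  HasSLETrace sleTrace sleDriving IsSLECurve IsSLELaw IsSLEDrivingCoupling IsCompactifiedImage
  brownianPath)

namespace Literature.Probability.LatticeModels

/-! ### `κ`-local transport: from a driving-process martingale to the SLE_κ law -/

/-- **Identification of the SLE_κ law from a Brownian coupling, `κ`-local form.** If `Γ` is an
a.e.-measurable random curve class on the canonical space which is almost surely the class of the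
time-compactified `φ.boundaryExtension`-image of the SLE_κ trace (the data of an SLE_κ random
curve *through* the chordal uniformizing map `φ` of `(D; a, b)`), then every law `μ` on
`CurveClass ℂ` admitting a Brownian coupling of its driving process through `φ`
(`IsSLEDrivingCoupling κ D φ μ ν`) is the chordal SLE_κ law of `(D; a, b)`: under `ν` the curve is
a.s. `Γ` of the path (uniqueness of the generating curve and of the compactified image), so
`μ = ν.map fst = P.map Γ`. This is the tree's `isSLELaw_of_isSLEDrivingCoupling`
(`SLEDrivingCoupling.lean`) with the SLE_κ random curve through `φ` supplied as a hypothesis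
instead of being built from the global trace theorems; same proof. (Duminil-Copin–Smirnov 2012,
p. 29: "this is exactly the definition of the chordal Schramm–Loewner Evolution … in the domain
`(Ω, a, b)`".) [cite: DuminilCopinSmirnov2012Clay, Prop. 6.7] -/
theorem isSLELaw_of_isSLEDrivingCoupling_through {κ : ℝ≥0} {D : DobrushinDomain}
    {φ : ConformalEquiv upperHalfPlaneSet D.carrier} {Γ : (ℝ≥0 → ℝ) → CurveClass ℂ}
    (hΓm : AEMeasurable Γ Process.preWienerMeasure)
    (hΓ : ∀ᵐ ω ∂Process.preWienerMeasure,
      RandomPlanarGeometry.Loewner.IsGeneratedByCurve (sleDriving κ ω) (sleTrace κ ω) ∧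
        ∃ c : Curve ℂ, Γ ω = CurveClass.mk c ∧
          IsCompactifiedImage φ.boundaryExtension (sleTrace κ ω) (D.pt 1) c)
    (hφ : D.IsChordalUniformizing φ) {μ : Measure (CurveClass ℂ)}
    {ν : Measure (CurveClass ℂ × (ℝ≥0 → ℝ))} (h : IsSLEDrivingCoupling κ D φ μ ν) :
    IsSLELaw κ D μ := by
  -- transport the description of `Γ` along the second projection
  have hΓ' : ∀ᵐ p ∂ν, ∃ c : Curve ℂ, Γ p.2 = CurveClass.mk c ∧
      IsCompactifiedImage φ.boundaryExtension (sleTrace κ p.2) (D.pt 1) c := by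
    have h' : ∀ᵐ ω ∂(ν.map Prod.snd), ∃ c : Curve ℂ, Γ ω = CurveClass.mk c ∧
        IsCompactifiedImage φ.boundaryExtension (sleTrace κ ω) (D.pt 1) c := by
      rw [h.map_snd]
      filter_upwards [hΓ] with ω hω
      exact hω.2
    exact ae_of_ae_map measurable_snd.aemeasurable h'
  -- under `ν`, the curve is `Γ` of the path
  have hae : (Prod.fst : CurveClass ℂ × (ℝ≥0 → ℝ) → CurveClass ℂ) =ᵐ[ν] Γ ∘ Prod.snd := by
    filter_upwards [h.ae_eq_mk_sleTrace, hΓ'] with p hp hp'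
    obtain ⟨-, c, hc, hcI⟩ := hp
    obtain ⟨c', hc', hc'I⟩ := hp'
    rw [Function.comp_apply, hc', hc, hcI.unique hc'I]
  have hΓm' : AEMeasurable Γ (ν.map Prod.snd) := by
    rw [h.map_snd]
    exact hΓm
  refine ⟨Γ, RandomPlanarGeometry.IsSLECurve.of_through hφ hΓm hΓ, ?_⟩
  rw [← h.map_fst, Measure.map_congr hae,
    ← AEMeasurable.map_map_of_aemeasurable hΓm' measurable_snd.aemeasurable, h.map_snd]

/-- **Martingale identification of chordal SLE_κ, `κ`-local form.** Let `κ > 0`, let `Γ` be an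
SLE_κ random curve through the chordal uniformizing map `φ` of `(D; a, b)` (as in
`isSLELaw_of_isSLEDrivingCoupling_through`), `ν` a probability measure on `CurveClass ℂ` and
`W : CurveClass ℂ → ([0, ∞) → ℝ)` a process on `(CurveClass ℂ, ν)` with measurable marginals, a.s.
continuous paths and `W 0 = 0` a.s., such that `ν`-a.e. `c` is driven by `W c` through `φ`
(`Loewner.IsDrivenBy`) and `X = (√κ)⁻¹ W` is a continuous local martingale with quadratic variation
`⟨X⟩ₜ = t` for some filtration. Then `ν` is the chordal SLE_κ law of `(D; a, b)`: Lévy's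
characterisation (the theorem `Process.levy_characterisation_holds`) makes `X` a Brownian motion,
whose path law is that of the canonical Brownian path (`map_paths_eq_map_brownianPath`), the tree's
`isSLEDrivingCoupling_of_drivingLaw_of_isDrivenBy` produces a Brownian coupling, and
`isSLELaw_of_isSLEDrivingCoupling_through` identifies the law. This is the tree's
`isSLELaw_of_isLocalMartingale_driving` (`SLELawOfDrivingProcess.lean`) with Lévy discharged and
the trace theorems replaced by the random curve `Γ`; same proof. (CDHKS 2014, §3: "As `W_t` is
almost surely continuous, Lévy's theorem implies that `W_t = √3 B_t`"; Duminil-Copin–Smirnov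
2012, Prop. 6.7.) [cite: CDHKSCRAS2014, §3] -/
theorem isSLELaw_of_isLocalMartingale_driving_through {κ : ℝ≥0} (hκ : 0 < κ) {D : DobrushinDomain}
    {φ : ConformalEquiv upperHalfPlaneSet D.carrier} {Γ : (ℝ≥0 → ℝ) → CurveClass ℂ}
    (hΓm : AEMeasurable Γ Process.preWienerMeasure)
    (hΓ : ∀ᵐ ω ∂Process.preWienerMeasure,
      RandomPlanarGeometry.Loewner.IsGeneratedByCurve (sleDriving κ ω) (sleTrace κ ω) ∧
        ∃ c : Curve ℂ, Γ ω = CurveClass.mk c ∧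
          IsCompactifiedImage φ.boundaryExtension (sleTrace κ ω) (D.pt 1) c)
    (hφ : D.IsChordalUniformizing φ) {ν : Measure (CurveClass ℂ)} [IsProbabilityMeasure ν]
    {W : CurveClass ℂ → ℝ≥0 → ℝ} (hWm : ∀ t, Measurable fun c ↦ W c t)
    (h0 : ∀ᵐ c ∂ν, W c 0 = 0) (hc : ∀ᵐ c ∂ν, Continuous (W c))
    {𝓕 : Filtration ℝ≥0 (inferInstance : MeasurableSpace (CurveClass ℂ))}
    (hM : RandomPlanarGeometry.IsLocalMartingale (fun t c ↦ (Real.sqrt κ)⁻¹ * W c t) 𝓕 ν)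
    (hQ : Process.HasQuadraticVariation (fun t c ↦ (Real.sqrt κ)⁻¹ * W c t) (fun t _ ↦ (t : ℝ)) 𝓕 ν)
    (hreg : ∀ᵐ c ∂ν, RandomPlanarGeometry.Loewner.IsDrivenBy φ.boundaryExtension (D.pt 1) (W c) c) :
    IsSLELaw κ D ν := by
  set X : ℝ≥0 → CurveClass ℂ → ℝ := fun t c ↦ (Real.sqrt κ)⁻¹ * W c t with hX
  have hXm : ∀ t, Measurable (X t) := fun t ↦ (hWm t).const_mul _
  have h0' : ∀ᵐ c ∂ν, X 0 c = 0 := by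
    filter_upwards [h0] with c hc0
    simp [hX, hc0]
  have hc' : ∀ᵐ c ∂ν, Continuous (X · c) := by
    filter_upwards [hc] with c hcc
    exact continuous_const.mul hcc
  have hBM : IsBrownianReal X ν := Process.levy_characterisation_holds hM h0' hc' hQ
  have hlaw : ν.map (fun c t ↦ X t c) = Process.preWienerMeasure.map brownianPath :=
    RandomPlanarGeometry.map_paths_eq_map_brownianPath hBM.toIsPreBrownianReal hXm
  have hsqrt : Real.sqrt κ ≠ 0 := (Real.sqrt_pos.2 (by exact_mod_cast hκ)).ne'
  have hWX : ∀ c, (fun t ↦ Real.sqrt κ * X t c) = W c := by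
    intro c
    funext t
    simp only [hX]
    rw [← mul_assoc, mul_inv_cancel₀ hsqrt, one_mul]
  obtain ⟨νc, hνc⟩ := RandomPlanarGeometry.isSLEDrivingCoupling_of_drivingLaw_of_isDrivenBy
    (κ := κ) (φ := φ) (fun c t ↦ X t c) (measurable_pi_lambda _ hXm).aemeasurable hlaw (by
      filter_upwards [hc', hreg] with c hcc hr
      exact ⟨hcc, by rw [hWX c]; exact hr⟩)
  exact isSLELaw_of_isSLEDrivingCoupling_through hΓm hΓ hφ hνc

/-! ### (L) from SLE_{16/3} random curves and the driving martingales -/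

/-- **(L) from the existence of SLE_{16/3} random curves and (L″).** If every Dobrushin domain
carries a chordal SLE_{16/3} random curve (equivalently, by `forall_exists_isSLECurve_iff`:
`HasSLETrace (16/3)` and a.s. transience of the SLE_{16/3} trace — Rohde–Schramm 2005, Thms 5.1
and 7.1 *at `κ = 16/3`*), then the driving-martingale fact (L″)
`exists_drivingMartingale_fkInterface` (Duminil-Copin–Smirnov 2012, Thm. 6.4 and proof of
Prop. 6.7) implies the identification fact (L): feed the uniformizing map of the SLE_{16/3} random
curve of `D` to (L″) (which is universal in the uniformizing map) and apply
`isSLELaw_of_isLocalMartingale_driving_through`. PROVED.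
[cite: DuminilCopinSmirnov2012Clay, Prop. 6.7 (proof, p. 29)] -/
theorem isSLELaw_of_isSubseqLimitLaw_fkInterfaceCurve_of_isSLECurve
    (hex : ∀ D : DobrushinDomain, ∃ Γ, IsSLECurve (16 / 3) D Γ)
    (hW : exists_drivingMartingale_fkInterface) :
    isSLELaw_of_isSubseqLimitLaw_fkInterfaceCurve := by
  intro D E hE μ hμ hlim
  obtain ⟨Γ, hΓm, φ, hφ, hΓ⟩ := hex D
  obtain ⟨W, 𝓕, hWm, h0, hc, hdrv, hM, hQ⟩ := hW D E hE μ hμ hlim φ hφ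
  haveI := hμ
  exact isSLELaw_of_isLocalMartingale_driving_through sixteen_thirds_pos hΓm hΓ hφ hWm h0 hc hM
    hQ hdrv

/-- `4 < 16/3` in `ℝ≥0` (the FK-Ising parameter lies in the Rohde–Schramm phase `(4, 8)`).
[folklore] -/
theorem four_lt_sixteen_thirds : (4 : ℝ≥0) < 16 / 3 := by
  have h' : ((4 : ℝ≥0) : ℝ) < ((16 / 3 : ℝ≥0) : ℝ) := by push_cast; norm_num
  exact_mod_cast h'

/-- `16/3 < 8` in `ℝ≥0`. [folklore] -/
theorem sixteen_thirds_lt_eight : (16 / 3 : ℝ≥0) < 8 := by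
  have h' : ((16 / 3 : ℝ≥0) : ℝ) < ((8 : ℝ≥0) : ℝ) := by push_cast; norm_num
  exact_mod_cast h'

/-- **SLE_{16/3} is generated by an a.s. transient curve, from Rohde–Schramm's Cor. 3.5 alone**:
`HasSLETrace (16/3)` is the tree's `hasSLETrace_of_ne_eight_of_cor35` (Thm. 5.1 from Cor. 3.5,
`16/3 ≠ 8`) and transience is `tendsto_norm_sleTrace_atTop_of_cor35_of_four_lt_of_lt_eight`
(Thm. 7.1 in the phase `4 < κ < 8`, proved in the tree along Lemma 7.3). PROVED.
[cite: RohdeSchramm2005, Thm 5.1 and Thm 7.1] -/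
theorem hasSLETrace_and_transient_sixteen_thirds_of_cor35
    (h35 : RandomPlanarGeometry.RohdeSchramm2005_cor35 Process.preWienerMeasure) :
    HasSLETrace (16 / 3) ∧
      ∀ᵐ ω ∂Process.preWienerMeasure, Tendsto (fun t ↦ ‖sleTrace (16 / 3) ω t‖) atTop atTop :=
  ⟨RandomPlanarGeometry.hasSLETrace_of_ne_eight_of_cor35 h35 sixteen_thirds_ne_eight,
    RandomPlanarGeometry.tendsto_norm_sleTrace_atTop_of_cor35_of_four_lt_of_lt_eight h35
      four_lt_sixteen_thirds sixteen_thirds_lt_eight⟩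

/-- **Chordal SLE_{16/3} random curves exist in every Dobrushin domain, from Rohde–Schramm's
Cor. 3.5** (`exists_isSLECurve_at` with `hasSLETrace_and_transient_sixteen_thirds_of_cor35`; the
Riemann–Carathéodory and measurability glue is proved in the tree). PROVED.
[cite: RohdeSchramm2005, Thm 5.1 and Thm 7.1] -/
theorem exists_isSLECurve_sixteen_thirds_of_cor35
    (h35 : RandomPlanarGeometry.RohdeSchramm2005_cor35 Process.preWienerMeasure) (D : DobrushinDomain) :
    ∃ Γ, IsSLECurve (16 / 3) D Γ :=
  RandomPlanarGeometry.exists_isSLECurve_at (hasSLETrace_and_transient_sixteen_thirds_of_cor35 h35).1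
    (hasSLETrace_and_transient_sixteen_thirds_of_cor35 h35).2 D

/-- **The named-fact frontier of (L).** The identification fact
`isSLELaw_of_isSubseqLimitLaw_fkInterfaceCurve` (every subsequential limit law of the critical
FK-Ising interfaces is the chordal SLE_{16/3} law; CDHKS 2014, Thm. 2 via Thm. 3 and §3;
Duminil-Copin–Smirnov 2012, Thm. 6.4 and Prop. 6.7) follows from exactly two named facts of the
tree: Rohde–Schramm's derivative estimate Cor. 3.5 for the canonical Brownian motion
(`RohdeSchramm2005_cor35 preWienerMeasure`) and the observable martingale fact (L‴)
(`exists_observableMartingale_fkInterface`), through the proved layer 4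
(`exists_drivingMartingale_fkInterface_of_observable`), Lévy's characterisation
(`Process.levy_characterisation_holds`) and the `κ`-local transport above. PROVED.
[cite: CDHKSCRAS2014, Thm. 3 and §3] [cite: DuminilCopinSmirnov2012Clay, Thm. 6.4 and Prop. 6.7] -/
theorem isSLELaw_of_isSubseqLimitLaw_fkInterfaceCurve_of_cor35
    (h35 : RandomPlanarGeometry.RohdeSchramm2005_cor35 Process.preWienerMeasure)
    (hobs : exists_observableMartingale_fkInterface) :
    isSLELaw_of_isSubseqLimitLaw_fkInterfaceCurve :=
  isSLELaw_of_isSubseqLimitLaw_fkInterfaceCurve_of_isSLECurve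
    (exists_isSLECurve_sixteen_thirds_of_cor35 h35)
    (exists_drivingMartingale_fkInterface_of_observable hobs)

/-- **CDHKS Theorem 2 from three named facts.** Crit-ising.S17 (FK half),
`convergesInLawToSLE_sixteen_thirds_fkInterface`, follows from Rohde–Schramm's Cor. 3.5
(`RohdeSchramm2005_cor35 preWienerMeasure`), the FK traversal bound (C1)
`fkInterface_traversalBound` (tightness; Duminil-Copin–Smirnov 2012, (6.2)) and the observable
martingale fact (L‴) `exists_observableMartingale_fkInterface`; uniqueness of the SLE law is
the theorem `IsSLECurve.map_eq_holds`. PROVED (layer-1 assembly via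
`convergesInLawToSLE_sixteen_thirds_fkInterface_of_traversalBound`). [cite: CDHKSCRAS2014, Thm. 2] -/
theorem convergesInLawToSLE_sixteen_thirds_fkInterface_of_cor35
    (h35 : RandomPlanarGeometry.RohdeSchramm2005_cor35 Process.preWienerMeasure)
    (h1 : fkInterface_traversalBound) (hobs : exists_observableMartingale_fkInterface) :
    convergesInLawToSLE_sixteen_thirds_fkInterface :=
  convergesInLawToSLE_sixteen_thirds_fkInterface_of_traversalBound
    RandomPlanarGeometry.IsSLECurve.map_eq_holds h1
    (isSLELaw_of_isSubseqLimitLaw_fkInterfaceCurve_of_cor35 h35 hobs)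

/-! ### (L) is implied by CDHKS Theorem 2 as transcribed -/

/-- **A subsequential limit law of a family converging in law is the limit law.** If the random
elements `Y δ` (laws `P δ`) converge in law along `𝓝[>] 0` to the random element `Z` under the
finite measure `P'` (`TendstoLaw`, bounded continuous test functions) with `Z` a.e.-measurable, then
every finite measure `μ` which is a subsequential limit law of the `Y δ` (`IsSubseqLimitLaw`) is
`P'.map Z`: along the mesh sequence both `∫ f dμ` and `∫ f d(P'.map Z)` are limits of the same real
sequence, and bounded continuous functions determine finite Borel measures on a metric space
(Mathlib's `ext_of_forall_integral_eq_of_IsFiniteMeasure`). (Billingsley 1999, Thm. 1.2 and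
Thm. 2.6.) [cite: BillingsleyCPM1999, Thm. 2.6] -/
theorem eq_map_of_isSubseqLimitLaw_of_tendstoLaw {Ωδ : ℝ → Type*} [∀ δ, MeasurableSpace (Ωδ δ)]
    {X : Type*} [PseudoMetricSpace X] [MeasurableSpace X] [BorelSpace X] {Ω' : Type*}
    [MeasurableSpace Ω'] {Y : ∀ δ, Ωδ δ → X} {P : ∀ δ, Measure (Ωδ δ)} {Z : Ω' → X}
    {P' : Measure Ω'} [IsFiniteMeasure P'] (h : RandomPlanarGeometry.TendstoLaw Y P Z P')
    (hZ : AEMeasurable Z P') {μ : Measure X} [IsFiniteMeasure μ]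
    (hμ : RandomPlanarGeometry.IsSubseqLimitLaw Y P μ) : μ = P'.map Z := by
  obtain ⟨s, hs, hlim⟩ := hμ
  refine ext_of_forall_integral_eq_of_IsFiniteMeasure fun f ↦ ?_
  rw [tendsto_nhds_unique (hlim f) ((h f).comp hs),
    integral_map hZ f.continuous.aestronglyMeasurable]

/-- **(L) follows from crit-ising.S17 (FK) as transcribed** (`convergesInLawToSLE_sixteen_thirds_fkInterface`,
CDHKS 2014, Thm. 2): if the FK interface laws of `(D, E)` converge in law to an SLE_{16/3} random
curve `Γ`, then every probability measure which is a subsequential limit law of them is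
`P.map Γ` (`eq_map_of_isSubseqLimitLaw_of_tendstoLaw`; the pre-Wiener measure is a probability
measure, `isProbabilityMeasure_preWienerMeasure'`), an SLE_{16/3} law. Hence (L) is no stronger
than the transcribed theorem; with the tightness fact (T) and uniqueness of the SLE law the two
are equivalent (`convergesInLawToSLE_sixteen_thirds_fkInterface_of_layer1`). PROVED.
[cite: CDHKSCRAS2014, Thm. 2] -/
theorem isSLELaw_of_isSubseqLimitLaw_fkInterfaceCurve_of_convergesInLawToSLE
    (h : convergesInLawToSLE_sixteen_thirds_fkInterface) :
    isSLELaw_of_isSubseqLimitLaw_fkInterfaceCurve := by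
  intro D E hE μ hμ hlim
  obtain ⟨Γ, hΓ, -, hlaw⟩ := h D E hE
  haveI := hμ
  haveI : IsProbabilityMeasure Process.preWienerMeasure :=
    RandomPlanarGeometry.isProbabilityMeasure_preWienerMeasure'
  exact ⟨Γ, hΓ, eq_map_of_isSubseqLimitLaw_of_tendstoLaw hlaw hΓ.aemeasurable hlim⟩

/-! ### The Rohde–Schramm inputs at `κ = 16/3` are necessary -/

/-- **(T) ∧ (L) exhibit an SLE_{16/3} random curve on every discretisable Dobrushin domain.**
Under the tightness fact (T) `isTightAlongMesh_fkInterfaceCurve`, the FK interface laws of a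
discretised Dobrushin domain `(D, E)` have a probability subsequential limit law (Prokhorov,
`IsTightAlongMesh.exists_isSubseqLimitLaw`; the interfaces are a.e.-measurable,
`eventually_aemeasurable_fkInterfaceCurve`), which (L) identifies as an SLE_{16/3} law, i.e. the
law of an SLE_{16/3} random curve in `D`. [folklore] -/
theorem exists_isSLECurve_sixteen_thirds_of_facts (hT : isTightAlongMesh_fkInterfaceCurve)
    (hL : isSLELaw_of_isSubseqLimitLaw_fkInterfaceCurve) {D : DobrushinDomain}
    {E : ℝ → DiscreteDobrushin} (hE : IsDiscretisation D E) :
    ∃ Γ, IsSLECurve (16 / 3) D Γ := by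
  obtain ⟨μ, hμ, hlim⟩ :=
    (hT D E hE).exists_isSubseqLimitLaw (eventually_aemeasurable_fkInterfaceCurve D E)
  obtain ⟨Γ, hΓ, -⟩ := hL D E hE μ hμ hlim
  exact ⟨Γ, hΓ⟩

/-- **The Rohde–Schramm theorems at `κ = 16/3` are consequences of (T) ∧ (L) on a non-vacuous
instance**: if some Dobrushin domain admits a family of admissible `δℤ²` discretisations
(`IsDiscretisation D E`), then (T) and (L) entail that SLE_{16/3} is generated by a curve
(`HasSLETrace (16/3)`, Rohde–Schramm 2005, Thm. 5.1 at `κ = 16/3`) and that its trace is a.s.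
transient (Thm. 7.1 at `κ = 16/3`), by `hasSLETrace_and_transient_of_isSLECurve`
(`SLEExistenceAt.lean`). So no proof of (L) bypasses these two theorems at `κ = 16/3`.
[cite: RohdeSchramm2005, Thm 5.1 and Thm 7.1] -/
theorem hasSLETrace_and_transient_sixteen_thirds_of_facts (hT : isTightAlongMesh_fkInterfaceCurve)
    (hL : isSLELaw_of_isSubseqLimitLaw_fkInterfaceCurve) {D : DobrushinDomain}
    {E : ℝ → DiscreteDobrushin} (hE : IsDiscretisation D E) :
    HasSLETrace (16 / 3) ∧
      ∀ᵐ ω ∂Process.preWienerMeasure, Tendsto (fun t ↦ ‖sleTrace (16 / 3) ω t‖) atTop atTop := by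
  obtain ⟨Γ, hΓ⟩ := exists_isSLECurve_sixteen_thirds_of_facts hT hL hE
  exact RandomPlanarGeometry.hasSLETrace_and_transient_of_isSLECurve hΓ

/-! ### Update: Rohde–Schramm's Cor. 3.5 is a theorem — the frontier of (L) is (L‴) alone -/

/-- **SLE_{16/3} is generated by an almost surely transient curve** (Rohde–Schramm 2005, Thm. 5.1
and Thm. 7.1 at `κ = 16/3`), unconditionally: Rohde–Schramm's one-point derivative estimate
Cor. 3.5 is a theorem of the tree on every probability space
(`RandomPlanarGeometry.RohdeSchramm2005_cor35_holds`), and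
`hasSLETrace_and_transient_sixteen_thirds_of_cor35` reads it at the canonical Brownian motion.
PROVED. [cite: RohdeSchramm2005, Thm 5.1 and Thm 7.1] -/
theorem hasSLETrace_and_transient_sixteen_thirds :
    HasSLETrace (16 / 3) ∧
      ∀ᵐ ω ∂Process.preWienerMeasure, Tendsto (fun t ↦ ‖sleTrace (16 / 3) ω t‖) atTop atTop :=
  hasSLETrace_and_transient_sixteen_thirds_of_cor35
    (RandomPlanarGeometry.RohdeSchramm2005_cor35_holds _)

/-- **Chordal SLE_{16/3} random curves exist in every Dobrushin domain `(D; a, b)`**,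
unconditionally (`exists_isSLECurve_sixteen_thirds_of_cor35` with
`RandomPlanarGeometry.RohdeSchramm2005_cor35_holds`): the object whose law CDHKS's Theorem 2
identifies as the scaling limit of the FK-Ising interfaces. PROVED.
[cite: RohdeSchramm2005, Thm 5.1 and Thm 7.1] -/
theorem exists_isSLECurve_sixteen_thirds (D : DobrushinDomain) : ∃ Γ, IsSLECurve (16 / 3) D Γ :=
  exists_isSLECurve_sixteen_thirds_of_cor35 (RandomPlanarGeometry.RohdeSchramm2005_cor35_holds _) D

/-- **(L) from (L″) alone.** The identification fact `isSLELaw_of_isSubseqLimitLaw_fkInterfaceCurve`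
follows from the driving-process martingale statement (L″) `exists_drivingMartingale_fkInterface`
of layer 3 (for a version `W` of the driving process of a subsequential limit, `W_t` and
`W_t² - (16/3) t` are local martingales; CDHKS 2014, §3; Duminil-Copin–Smirnov 2012, proof of
Prop. 6.7) and nothing else: Lévy's characterisation and the SLE_{16/3} random curve through the
uniformizing map are theorems (`isSLELaw_of_isSubseqLimitLaw_fkInterfaceCurve_of_isSLECurve`,
`exists_isSLECurve_sixteen_thirds`). PROVED. [cite: CDHKSCRAS2014, §3]
[cite: DuminilCopinSmirnov2012Clay, Prop. 6.7 (proof, p. 29)] -/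
theorem isSLELaw_of_isSubseqLimitLaw_fkInterfaceCurve_of_exists_drivingMartingale
    (hW : exists_drivingMartingale_fkInterface) : isSLELaw_of_isSubseqLimitLaw_fkInterfaceCurve :=
  isSLELaw_of_isSubseqLimitLaw_fkInterfaceCurve_of_isSLECurve exists_isSLECurve_sixteen_thirds hW

/-- **(L) from (L‴) alone — the named-fact frontier of (L) is one fact**: the stopped-observable
martingale statement (L‴) `exists_observableMartingale_fkInterface` of layer 4 (Duminil-Copin–
Smirnov 2012, proof of Prop. 6.7; CDHKS 2014, Thm. 3 and §3) implies (L″) by the proved far-field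
expansion (`exists_drivingMartingale_fkInterface_of_observable`), hence (L): Rohde–Schramm's
Cor. 3.5 (`RandomPlanarGeometry.RohdeSchramm2005_cor35_holds`), Lévy's characterisation
(`Process.levy_characterisation_holds`) and layers 2–4 are theorems of the tree. PROVED.
[cite: CDHKSCRAS2014, Thm. 3 and §3] [cite: DuminilCopinSmirnov2012Clay, Thm. 6.4 and Prop. 6.7] -/
theorem isSLELaw_of_isSubseqLimitLaw_fkInterfaceCurve_of_exists_observableMartingale
    (h : exists_observableMartingale_fkInterface) : isSLELaw_of_isSubseqLimitLaw_fkInterfaceCurve :=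
  isSLELaw_of_isSubseqLimitLaw_fkInterfaceCurve_of_exists_drivingMartingale
    (exists_drivingMartingale_fkInterface_of_observable h)

end Literature.Probability.LatticeModels
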